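import Literature.InformationTheory.QuantumCodes.ToricCodeDistance
import Literature.InformationTheory.QuantumCodes.PlanarSurfaceCodeRadius
import Literature.InformationTheory.QuantumCodes.CSSPhenomenologicalRadius
import Literature.InformationTheory.QuantumCodes.ToricCodeMatching
import Literature.InformationTheory.QuantumCodes.PlanarCodeMatching
import HarnessLib

/-!
# The correction RADIUS of minimum-weight perfect matching: `⌊(L-1)/2⌋` exactly on the `L × L` toric code (both
# sectors), `⌊(k+1)/2⌋` exactly on the planar codes (MWPM with a boundary node), `⌊(L-1)/2⌋` space-time faults with
# `T` noisy rounds — deterministic, UNCONDITIONAL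

Venture QEC, `Summits/Ventures/QEC/Decoders/` (LADDER-QEC rung Q4 «certified correction radius of a specified decoder»;
qec-type-09 gen 4, item 09.MWPM). The tree proves the optimal radius `⌊(d-1)/2⌋` for every MINIMUM-WEIGHT decoder
(`ToricCode.minWeight_isCorrectionRadius`, `PlanarCode.minWeight_isCorrectionRadiusZ/X`, type-08; space-time
`ToricCode.st_correctsUpTo_half_of_isMinWeight`, lit-2). By the Edmonds–Johnson theorem of `MatchingDecoders.lean`
(`IsMatchingDecoder.isMinWeight`) through the toric/planar bridges (`ToricCodeMatching.lean`, `MatchingDecodersBoundary.lean`,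
`PlanarCodeMatching.lean`), the SAME radius holds for EVERY minimum-weight-perfect-matching decoder — any admissible link
metric, any tie-break among minimum-cost matchings, any geodesics; for the planar codes, any presentation `ι` with a
virtual boundary check. All PROVED, kernel axioms, 0 facts, 0 `native_decide` (no certificate search: structural theorems):

| theorem | statement |
|---|---|
| `toric_mwpm_isCorrectionRadiusZ` | `L × L` toric code, star-syndrome MWPM: radius EXACTLY `⌊(L-1)/2⌋` (corrects every `Z`-chain of `≤ ⌊(L-1)/2⌋` links, fails on some chain with one more) |
| `toric_mwpm_isCorrectionRadiusX` | plaquette-syndrome MWPM: radius EXACTLY `⌊(L-1)/2⌋` |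
| `toric_st_mwpm_correctsUpTo_half` | `T` noisy rounds, space-time MWPM: every history with `≤ ⌊(L-1)/2⌋` faults (qubit + measurement) is corrected |
| `planar_mwpm_isCorrectionRadiusZ` / `…X` | `k`-th planar code, boundary-MWPM of either syndrome: radius EXACTLY `⌊(k+1)/2⌋` |

## References
* [DennisEtAl2002] E. Dennis, A. Kitaev, A. Landahl, J. Preskill, *Topological quantum memory*, J. Math. Phys. 43
  (2002) 4452–4505, arXiv:quant-ph/0110143, §3.1 (weight less than half the distance), §4.4 p. 18, §5.1 p. 19.
* [DelfosseNickerson2021] N. Delfosse, N. H. Nickerson, *Almost-linear time decoding algorithm for topological codes*,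
  Quantum 5 (2021) 595, §3 ¶2 (up to (d−1)/2, tight).
* [KorteVygen2002] B. Korte, J. Vygen, *Combinatorial Optimization*, Springer (2002), §12.2 Thm 12.9 (Edmonds–Johnson).
-/

namespace Summit.Ventures.QEC.Decoders

open Finset Matrix
open Literature.InformationTheory.QuantumCodes
open Literature.InformationTheory.QuantumCodes.ToricCode

/-! ### Toric code, perfect measurement -/

/-- **MWPM of the star syndrome has correction radius EXACTLY `⌊(L-1)/2⌋` on the `L × L` toric code** (every
admissible link metric, tie-break, geodesics). UNCONDITIONAL. [cite: DennisEtAl2002, §3.1 and §4.4 p. 18] -/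
theorem toric_mwpm_isCorrectionRadiusZ (L : ℕ) [NeZero L] {m : EdgeMetric (starEnds L)} {D : ZDecoder L}
    (hD : IsMatchingDecoder m D) : D.IsCorrectionRadius (syn L) (boundaries L) hammingNorm ((L - 1) / 2) :=
  minWeight_isCorrectionRadius (isMinWeight_of_isMatchingDecoder_star hD)

/-- **MWPM of the plaquette syndrome has correction radius EXACTLY `⌊(L-1)/2⌋`** (bit flips on the `L × L` toric
code). UNCONDITIONAL. [cite: DennisEtAl2002, §3.1 and §4.4 p. 18] -/
theorem toric_mwpm_isCorrectionRadiusX (L : ℕ) [NeZero L] {m : EdgeMetric (plaqEnds L)}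
    {D : Decoder (Syndrome L) (Chain L)} (hD : IsMatchingDecoder m D) :
    D.IsCorrectionRadius (toricCode L).xSyndrome ((toricCode L).rowSpX : Set (Chain L)) hammingNorm ((L - 1) / 2) := by
  have h := (toricCode L).isCorrectionRadiusX_of_isMinWeight (isMinWeight_of_isMatchingDecoder_plaq hD) exists_xLogical
  rwa [toricCode_dX] at h

/-! ### Toric code, `T` noisy rounds (space-time matching) -/

/-- **Space-time MWPM corrects every `⌊(L-1)/2⌋` faults** of a `T`-round memory experiment on the `L × L` toric code
(qubit errors and wrong site-operator outcomes counted together; any `T`, any admissible space-time link metric,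
tie-break, geodesics): the residual `Π(E + D(∂E))` is a plaquette boundary. UNCONDITIONAL.
[cite: DennisEtAl2002, §5.1 p. 19 and §5.2 (a homologically nontrivial path contains at least L links)] -/
theorem toric_st_mwpm_correctsUpTo_half (L T : ℕ) [NeZero L] {m : EdgeMetric (stLinkEnds L T)} {D : STDecoder L T}
    (hD : IsMatchingDecoder m D) : D.CorrectsUpTo (stSyn L T) (stTrivial L T) hammingNorm ((L - 1) / 2) :=
  st_correctsUpTo_half_of_isMinWeight D (isMinWeight_of_isMatchingDecoder_st hD)

/-! ### Planar surface codes (MWPM with a virtual boundary check) -/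

/-- **Boundary-MWPM of the `X`-check syndrome of the `k`-th planar code has correction radius EXACTLY `⌊(k+1)/2⌋`**
(phase flips; any presentation `ι` of `planarHX k` as graphlike with boundary — one exists by
`exists_isGraphlikeVia_planarHX` —, any link metric, tie-break, geodesics). UNCONDITIONAL.
[cite: DennisEtAl2002, §3.2 (planar codes) and §4.4 p. 18] -/
theorem planar_mwpm_isCorrectionRadiusZ (k : ℕ) {ι : PlanarQubit k → Sym2 (Option (PlanarCheck k))}
    (hι : IsGraphlikeVia (planarHX k) ι) {m : EdgeMetric ι}
    {D' : Decoder (Option (PlanarCheck k) → ZMod 2) (PlanarQubit k → ZMod 2)} (hD : IsMatchingDecoder m D') :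
    (boundaryDecoder D').IsCorrectionRadius (PlanarCode.code k).zSyndrome
      ((PlanarCode.code k).rowSpZ : Set (PlanarQubit k → ZMod 2)) hammingNorm ((k + 1) / 2) :=
  PlanarCode.minWeight_isCorrectionRadiusZ k (isMinWeight_boundaryDecoder hι hD)

/-- **Boundary-MWPM of the `Z`-check syndrome of the `k`-th planar code has correction radius EXACTLY `⌊(k+1)/2⌋`**
(bit flips). UNCONDITIONAL. [cite: DennisEtAl2002, §3.2 and §4.4 p. 18] -/
theorem planar_mwpm_isCorrectionRadiusX (k : ℕ) {ι : PlanarQubit k → Sym2 (Option (PlanarZCheck k))}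
    (hι : IsGraphlikeVia (planarHZ k) ι) {m : EdgeMetric ι}
    {D' : Decoder (Option (PlanarZCheck k) → ZMod 2) (PlanarQubit k → ZMod 2)} (hD : IsMatchingDecoder m D') :
    (boundaryDecoder D').IsCorrectionRadius (PlanarCode.code k).xSyndrome
      ((PlanarCode.code k).rowSpX : Set (PlanarQubit k → ZMod 2)) hammingNorm ((k + 1) / 2) :=
  PlanarCode.minWeight_isCorrectionRadiusX k (isMinWeight_boundaryDecoder hι hD)

end Summit.Ventures.QEC.Decoders
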